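import Literature.Analysis.Complex.RectangleCauchyDerivatives
import HarnessLib

/-!
# Barrier (Schanuel) `NesterenkoModularScope`: the residue computation (12)–(13) of LNM 1752 Ch. 3 Lemma 3.3 — proofs only

`Literature/Barriers/Schanuel/NesterenkoModularScopeResidues.lean` — sibling proofs file of
`NesterenkoModularScope.lean` (barrier `NesterenkoModularScope := nesterenko1996_thm_1_1`,
LNM 1752 Ch. 3 Theorem 1.1). No new definitions; pure complex analysis, proofs only.

The proof of LNM 1752 Ch. 3 Lemma 3.3 (the interpolation step, p. 36) evaluates the integral
`I = (2πi)⁻¹ ∮_{|z| = r} F(z) z^{−M−1} ((r² − q̄z)/(r(z − q)))^{L+1} dz` by the residue theorem,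
(12) `I = Res_{z=0} G + Res_{z=q} G`, the pole at `q` having order `L + 1` ((13): a Leibniz sum of
Taylor coefficients at `q`). Mathlib has no residue theorem; this file proves exactly the instance
needed, for a function `g` holomorphic on a neighbourhood of the closed disc `|z| ≤ R` and a point
`0 < |q| < R`:

* `circleIntegral_inv_mul_inv_sub_pow_eq_zero` — `∮_{|z|=R} dz /(z (z − q)^{m+1}) = 0`
  (partial fractions `1/(z(z−q)) = q⁻¹ (1/(z−q) − 1/z)` and induction on `m`);
* `circleIntegral_inv_mul_inv_sub_pow_mul` — **`∮_{|z|=R} g(z) dz /(z (z − q)^n) = 2πi · aₙ(0)`**,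
  where `aₙ = (swap dslope q)^[n] g` is the `n`-th iterated divided difference of `g` at `q`
  (induction on `n` via `g(z) = g(q) + (z − q)·(dslope g q)(z)`; `n = 0` is Cauchy's formula);
* `eq_sum_add_pow_mul_iterate_dslope` — Taylor's formula with the divided-difference remainder,
  `g(b) = ∑_{k<n} a_k(q)(b − q)^k + (b − q)^n aₙ(b)`, `a_k(q) = g^{(k)}(q)/k!`
  (`Literature.Analysis.Complex.iterate_dslope_apply_eq_iteratedDeriv_div`);
* `circleIntegral_residue_identity` — combining the two at `b = 0`:
  **`(−q)^n ∮_{|z|=R} g(z) dz/(z (z−q)^n) = 2πi (g(0) − ∑_{k<n} (g^{(k)}(q)/k!) (−q)^k)`**, i.e.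
  (12)–(13) with both residues made explicit; and the resulting estimate
  `norm_le_of_circleIntegral_residue_identity`:
  `‖g(0)‖ ≤ ‖q‖^n R C + ∑_{k<n} ‖g^{(k)}(q)‖/k! ‖q‖^k` whenever `‖g(z)/(z (z−q)^n)‖ ≤ C` on `|z| = R`.

## References

* [NesterenkoPhilippon2001] Yu. V. Nesterenko, P. Philippon (eds.), *Introduction to Algebraic
  Independence Theory*, LNM 1752, Springer 2001, Ch. 3 §3, proof of Lemma 3.3 ((10)–(13), p. 36).
* L. V. Ahlfors, *Complex Analysis*, 3rd ed., Ch. 4 §5 (residue theorem). [folklore]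
-/

noncomputable section

open Complex Set Function Filter Topology Metric
open scoped Real
open Literature.Analysis.Complex

namespace Literature.Barriers.Schanuel

/-! ### `∮ dz / (z (z − q)^{m+1}) = 0` -/

/-- On the circle `|z| = R` with `|q| < R` the points `0` and `q` are avoided. [folklore] -/
theorem ne_zero_and_ne_of_mem_sphere {q z : ℂ} {R : ℝ} (hqR : ‖q‖ < R) (hz : z ∈ sphere (0 : ℂ) R) :
    z ≠ 0 ∧ z ≠ q := by
  rw [mem_sphere, dist_zero_right] at hz
  have hR : 0 < R := (norm_nonneg q).trans_lt hqR
  refine ⟨fun h => ?_, fun h => ?_⟩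
  · rw [h, norm_zero] at hz; exact hR.ne hz
  · rw [h] at hz; exact hqR.ne hz

/-- Partial fractions on the circle: `1/(z (z−q)^{m+1}) = q⁻¹ ((z−q)^{−(m+1)} − 1/(z (z−q)^m))`.
[folklore] -/
theorem inv_mul_inv_sub_pow_succ {q z : ℂ} (hq : q ≠ 0) (hz : z ≠ 0) (hzq : z ≠ q) (m : ℕ) :
    z⁻¹ * ((z - q) ^ (m + 1))⁻¹ =
      q⁻¹ * (((z - q) ^ (m + 1))⁻¹ - z⁻¹ * ((z - q) ^ m)⁻¹) := by
  have hzq' : z - q ≠ 0 := sub_ne_zero.2 hzq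
  field_simp
  ring

/-- **`∮_{|z|=R} dz / (z (z − q)^{m+1}) = 0`** for `0 < |q| < R` (the two residues
`(−q)^{−(m+1)}` and `−(−q)^{−(m+1)}` cancel). [folklore] -/
theorem circleIntegral_inv_mul_inv_sub_pow_eq_zero {q : ℂ} {R : ℝ} (hq : q ≠ 0) (hqR : ‖q‖ < R) :
    ∀ m : ℕ, (∮ z in C(0, R), z⁻¹ * ((z - q) ^ (m + 1))⁻¹) = 0 := by
  have hR : 0 < R := (norm_nonneg q).trans_lt hqR
  have hqball : q ∈ ball (0 : ℂ) R := by simpa using hqR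
  -- continuity of the pieces on the circle
  have hc_inv : ContinuousOn (fun z : ℂ => z⁻¹) (sphere (0 : ℂ) R) := fun z hz =>
    (continuousAt_inv₀ (ne_zero_and_ne_of_mem_sphere hqR hz).1).continuousWithinAt
  have hc_pow : ∀ k : ℕ, ContinuousOn (fun z : ℂ => ((z - q) ^ k)⁻¹) (sphere (0 : ℂ) R) :=
    fun k z hz => ((continuousAt_id.sub continuousAt_const).pow k).continuousWithinAt.inv₀
      (pow_ne_zero _ (sub_ne_zero.2 (ne_zero_and_ne_of_mem_sphere hqR hz).2))
  have hint : ∀ k : ℕ, CircleIntegrable (fun z : ℂ => z⁻¹ * ((z - q) ^ k)⁻¹) 0 R :=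
    fun k => (hc_inv.mul (hc_pow k)).circleIntegrable hR.le
  have hzpow : ∀ (m : ℕ) (z : ℂ), ((z - q) ^ (m + 1))⁻¹ = (z - q) ^ (-((m + 1 : ℕ) : ℤ)) := by
    intro m z; rw [zpow_neg, zpow_natCast]
  intro m
  induction m with
  | zero =>
    have heq : EqOn (fun z : ℂ => z⁻¹ * ((z - q) ^ (0 + 1))⁻¹)
        (fun z => q⁻¹ * ((z - q)⁻¹ - (z - 0)⁻¹)) (sphere (0 : ℂ) R) := by
      intro z hz
      obtain ⟨hz0, hzq⟩ := ne_zero_and_ne_of_mem_sphere hqR hz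
      have := inv_mul_inv_sub_pow_succ hq hz0 hzq 0
      simp only [pow_zero, inv_one, mul_one, zero_add, pow_one, sub_zero] at this ⊢
      exact this
    rw [circleIntegral.integral_congr hR.le heq, circleIntegral.integral_const_mul,
      circleIntegral.integral_sub, circleIntegral.integral_sub_inv_of_mem_ball hqball,
      circleIntegral.integral_sub_inv_of_mem_ball (mem_ball_self hR), sub_self, mul_zero]
    · exact ((continuousOn_id.sub continuousOn_const).inv₀
        fun z hz => sub_ne_zero.2 (ne_zero_and_ne_of_mem_sphere hqR hz).2).circleIntegrable hR.le
    · simp_rw [sub_zero]; exact hc_inv.circleIntegrable hR.le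
  | succ m ih =>
    have heq : EqOn (fun z : ℂ => z⁻¹ * ((z - q) ^ (m + 1 + 1))⁻¹)
        (fun z => q⁻¹ * ((z - q) ^ (-((m + 1 + 1 : ℕ) : ℤ)) - z⁻¹ * ((z - q) ^ (m + 1))⁻¹))
        (sphere (0 : ℂ) R) := by
      intro z hz
      obtain ⟨hz0, hzq⟩ := ne_zero_and_ne_of_mem_sphere hqR hz
      simp only [← hzpow]
      exact inv_mul_inv_sub_pow_succ hq hz0 hzq (m + 1)
    rw [circleIntegral.integral_congr hR.le heq, circleIntegral.integral_const_mul,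
      circleIntegral.integral_sub, ih, circleIntegral.integral_sub_zpow_of_ne (by omega), sub_self,
      mul_zero]
    · simp_rw [← hzpow]
      exact (hc_pow (m + 1 + 1)).circleIntegrable hR.le
    · exact hint (m + 1)

/-! ### `∮ g(z) dz / (z (z − q)^n) = 2πi aₙ(0)` -/

/-- **Cauchy's formula with a pole of order `n` off the centre**: for `g` holomorphic on an open
`U ⊇ {|z| ≤ R}` and `0 < |q| < R`,
`∮_{|z|=R} g(z) dz / (z (z − q)^n) = 2πi · ((swap dslope q)^[n] g)(0)`, the value at `0` of the
`n`-th iterated divided difference of `g` at `q`. Induction on `n`: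
`g(z) = g(q) + (z − q)(dslope g q)(z)` and `∮ dz/(z (z−q)^{n+1}) = 0`; `n = 0` is Cauchy's
integral formula. [folklore] -/
theorem circleIntegral_inv_mul_inv_sub_pow_mul {U : Set ℂ} (hU : IsOpen U) {R : ℝ}
    (hRU : closedBall (0 : ℂ) R ⊆ U) {q : ℂ} (hq : q ≠ 0) (hqR : ‖q‖ < R) :
    ∀ (n : ℕ) {g : ℂ → ℂ}, DifferentiableOn ℂ g U →
      (∮ z in C(0, R), z⁻¹ * ((z - q) ^ n)⁻¹ * g z) = 2 * π * I * ((swap dslope q)^[n] g) 0 := by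
  have hR : 0 < R := (norm_nonneg q).trans_lt hqR
  have hqball : q ∈ ball (0 : ℂ) R := by simpa using hqR
  have hUq : U ∈ 𝓝 q := hU.mem_nhds (hRU (ball_subset_closedBall hqball))
  intro n
  induction n with
  | zero =>
    intro g hg
    have heq : EqOn (fun z : ℂ => z⁻¹ * ((z - q) ^ 0)⁻¹ * g z) (fun z => (z - 0)⁻¹ • g z)
        (sphere (0 : ℂ) R) := by
      intro z _; simp
    rw [circleIntegral.integral_congr hR.le heq,
      (hg.diffContOnCl_ball hRU).circleIntegral_sub_inv_smul (mem_ball_self hR)]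
    simp
  | succ n ih =>
    intro g hg
    have hdg : DifferentiableOn ℂ (dslope g q) U := (Complex.differentiableOn_dslope hUq).2 hg
    have heq : EqOn (fun z : ℂ => z⁻¹ * ((z - q) ^ (n + 1))⁻¹ * g z)
        (fun z => g q * (z⁻¹ * ((z - q) ^ (n + 1))⁻¹) + z⁻¹ * ((z - q) ^ n)⁻¹ * dslope g q z)
        (sphere (0 : ℂ) R) := by
      intro z hz
      obtain ⟨hz0, hzq⟩ := ne_zero_and_ne_of_mem_sphere hqR hz
      have hzq' : z - q ≠ 0 := sub_ne_zero.2 hzq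
      simp only
      rw [eq_add_sub_mul_dslope g q z]
      field_simp
      ring
    -- integrability of the two pieces
    have hc_inv : ContinuousOn (fun z : ℂ => z⁻¹) (sphere (0 : ℂ) R) := fun z hz =>
      (continuousAt_inv₀ (ne_zero_and_ne_of_mem_sphere hqR hz).1).continuousWithinAt
    have hc_pow : ∀ k : ℕ, ContinuousOn (fun z : ℂ => ((z - q) ^ k)⁻¹) (sphere (0 : ℂ) R) :=
      fun k z hz => ((continuousAt_id.sub continuousAt_const).pow k).continuousWithinAt.inv₀
        (pow_ne_zero _ (sub_ne_zero.2 (ne_zero_and_ne_of_mem_sphere hqR hz).2))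
    have hsph : sphere (0 : ℂ) R ⊆ U := sphere_subset_closedBall.trans hRU
    have h1 : CircleIntegrable (fun z : ℂ => g q * (z⁻¹ * ((z - q) ^ (n + 1))⁻¹)) 0 R :=
      (continuousOn_const.mul (hc_inv.mul (hc_pow (n + 1)))).circleIntegrable hR.le
    have h2 : CircleIntegrable (fun z : ℂ => z⁻¹ * ((z - q) ^ n)⁻¹ * dslope g q z) 0 R :=
      ((hc_inv.mul (hc_pow n)).mul (hdg.continuousOn.mono hsph)).circleIntegrable hR.le
    rw [circleIntegral.integral_congr hR.le heq, circleIntegral.integral_add h1 h2,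
      circleIntegral.integral_const_mul, circleIntegral_inv_mul_inv_sub_pow_eq_zero hq hqR n,
      mul_zero, zero_add, ih hdg, Function.iterate_succ_apply]

/-! ### Taylor's formula with divided-difference remainder -/

/-- **Taylor's formula with remainder in divided differences**:
`g(b) = ∑_{k<n} a_k(q) (b − q)^k + (b − q)^n aₙ(b)` with `a_k = (swap dslope q)^[k] g` (an
identity for every function `g : ℂ → ℂ` and all `b`, by `g(b) = g(q) + (b − q)(dslope g q)(b)`
and induction). [folklore] -/
theorem eq_sum_add_pow_mul_iterate_dslope (g : ℂ → ℂ) (q b : ℂ) : ∀ n : ℕ,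
    g b = ∑ k ∈ Finset.range n, ((swap dslope q)^[k] g) q * (b - q) ^ k +
      (b - q) ^ n * ((swap dslope q)^[n] g) b
  | 0 => by simp
  | n + 1 => by
    rw [Finset.sum_range_succ, Function.iterate_succ_apply', eq_sum_add_pow_mul_iterate_dslope g q b n]
    have h := eq_add_sub_mul_dslope ((swap dslope q)^[n] g) q b
    rw [h]
    simp only [swap]
    ring

/-! ### The residue identity and the resulting estimate -/

/-- **(12)–(13) made explicit**: for `g` holomorphic on an open `U ⊇ {|z| ≤ R}`, `0 < |q| < R`
and `n ∈ ℕ`,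
`(−q)^n ∮_{|z|=R} g(z) dz/(z (z − q)^n) = 2πi (g(0) − ∑_{k<n} (g^{(k)}(q)/k!) (−q)^k)`
(the residue at `0` is `g(0)(−q)^{−n}`, the residue at `q` is `−(−q)^{−n} ∑_{k<n} (g^{(k)}(q)/k!)(−q)^k`).
[cite: NesterenkoPhilippon2001, Ch. 3 §3 proof of Lemma 3.3 ((12)–(13), p. 36)] -/
theorem circleIntegral_residue_identity {U : Set ℂ} (hU : IsOpen U) {R : ℝ}
    (hRU : closedBall (0 : ℂ) R ⊆ U) {q : ℂ} (hq : q ≠ 0) (hqR : ‖q‖ < R) (n : ℕ) {g : ℂ → ℂ}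
    (hg : DifferentiableOn ℂ g U) :
    (-q) ^ n * (∮ z in C(0, R), z⁻¹ * ((z - q) ^ n)⁻¹ * g z) =
      2 * π * I * (g 0 - ∑ k ∈ Finset.range n,
        iteratedDeriv k g q / (k.factorial : ℂ) * (-q) ^ k) := by
  have hqball : q ∈ ball (0 : ℂ) R := by simpa using hqR
  have hUq : U ∈ 𝓝 q := hU.mem_nhds (hRU (ball_subset_closedBall hqball))
  rw [circleIntegral_inv_mul_inv_sub_pow_mul hU hRU hq hqR n hg]
  have htaylor := eq_sum_add_pow_mul_iterate_dslope g q 0 n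
  simp only [zero_sub] at htaylor
  have hcoef : ∀ k ∈ Finset.range n, ((swap dslope q)^[k] g) q * (-q) ^ k =
      iteratedDeriv k g q / (k.factorial : ℂ) * (-q) ^ k := fun k _ => by
    rw [iterate_dslope_apply_eq_iteratedDeriv_div hUq hg k]
  rw [← Finset.sum_congr rfl hcoef]
  linear_combination -(2 * π * I) * htaylor

/-- **The estimate behind Lemma 3.3**: if moreover `‖g(z)/(z (z − q)^n)‖ ≤ C` on `|z| = R`, then
`‖g(0)‖ ≤ ‖q‖^n R C + ∑_{k<n} (‖g^{(k)}(q)‖/k!) ‖q‖^k`.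
[cite: NesterenkoPhilippon2001, Ch. 3 §3 proof of Lemma 3.3 ((11)–(13), p. 36)] -/
theorem norm_le_of_circleIntegral_residue_identity {U : Set ℂ} (hU : IsOpen U) {R : ℝ}
    (hRU : closedBall (0 : ℂ) R ⊆ U) {q : ℂ} (hq : q ≠ 0) (hqR : ‖q‖ < R) (n : ℕ) {g : ℂ → ℂ}
    (hg : DifferentiableOn ℂ g U) {C : ℝ}
    (hC : ∀ z ∈ sphere (0 : ℂ) R, ‖z⁻¹ * ((z - q) ^ n)⁻¹ * g z‖ ≤ C) :
    ‖g 0‖ ≤ ‖q‖ ^ n * (R * C) +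
      ∑ k ∈ Finset.range n, ‖iteratedDeriv k g q‖ / (k.factorial : ℝ) * ‖q‖ ^ k := by
  have hR : 0 < R := (norm_nonneg q).trans_lt hqR
  have hid := circleIntegral_residue_identity hU hRU hq hqR n hg
  set S : ℂ := ∑ k ∈ Finset.range n, iteratedDeriv k g q / (k.factorial : ℂ) * (-q) ^ k with hS
  have hint : ‖∮ z in C(0, R), z⁻¹ * ((z - q) ^ n)⁻¹ * g z‖ ≤ 2 * π * R * C :=
    circleIntegral.norm_integral_le_of_norm_le_const hR.le hC
  have h2pi : ‖(2 * π * I : ℂ)‖ = 2 * π := by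
    rw [norm_mul, norm_mul, Complex.norm_I, mul_one, Complex.norm_two, Complex.norm_real,
      Real.norm_eq_abs, abs_of_pos Real.pi_pos]
  have hdiff : 2 * π * ‖g 0 - S‖ ≤ 2 * π * (‖q‖ ^ n * (R * C)) := by
    have h := congrArg (fun w : ℂ => ‖w‖) hid
    simp only [norm_mul, norm_pow, norm_neg, h2pi] at h
    rw [← h]
    calc ‖q‖ ^ n * ‖∮ z in C(0, R), z⁻¹ * ((z - q) ^ n)⁻¹ * g z‖
        ≤ ‖q‖ ^ n * (2 * π * R * C) := mul_le_mul_of_nonneg_left hint (pow_nonneg (norm_nonneg _) _)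
      _ = 2 * π * (‖q‖ ^ n * (R * C)) := by ring
  have hdiff' : ‖g 0 - S‖ ≤ ‖q‖ ^ n * (R * C) := le_of_mul_le_mul_left hdiff Real.two_pi_pos
  have hSn : ‖S‖ ≤ ∑ k ∈ Finset.range n, ‖iteratedDeriv k g q‖ / (k.factorial : ℝ) * ‖q‖ ^ k := by
    refine (norm_sum_le _ _).trans (Finset.sum_le_sum fun k _ => ?_)
    rw [norm_mul, norm_div, norm_pow, norm_neg, Complex.norm_natCast]
  calc ‖g 0‖ = ‖(g 0 - S) + S‖ := by rw [sub_add_cancel]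
    _ ≤ ‖g 0 - S‖ + ‖S‖ := norm_add_le _ _
    _ ≤ _ := add_le_add hdiff' hSn

end Literature.Barriers.Schanuel

end
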